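import Mathlib
import Literature.Probability.Entropy.BinaryRelativeEntropy
import Literature.InformationTheory.Entropy.GibbsInequality
import Summits.Ventures.LatticeQCDFlow.Scaling.ImportanceWeights

/-!
# LatticeQCDFlow / Scaling — sector-weight budget (T2-P) and event / concentration budget (T2-O)

HONEST FRAMING: exact (Metropolis-corrected) sampling algorithms for lattice gauge theory;
figures of merit are autocorrelation/cost numbers at stated couplings and volumes; no
continuum-physics claim.

Venture `LatticeQCDFlow` (cell pub-lqcd), topic `Scaling`, items T2-P and T2-O/T2-O′ of
HOME/THEORY-2.md §4 (v1.4), landed by FANOUT row 31 from `HOME/THEORY-2-Sketch.lean` (theory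
seat, farm-checked; decls verbatim).  Finite state space `X`, target `p`, model `q`.

* **T2-P** — for ANY coarse-graining `π : X → Y` (topological charge, Polyakov-loop sector, an
  action-histogram bin): `ESS(p,q) ≤ ESS(π_*p, π_*q)` (`essFrac_le_essFrac_coarse`) and
  `D(π_*p‖π_*q) ≤ D(p‖q)` (`klFin_coarse_le`) — data processing for `χ²` and KL
  ([folklore]; Polyanskiy–Wu, *Information Theory* Thm 7.4).  The whole sampler's reweighting
  ESS is capped by how well the model reproduces the SECTOR WEIGHTS alone (e.g. `p_A = 0.2` at
  `q_A = 0.02` caps ESS at `≤ 0.377` however good the intra-sector model is); generalises T2-K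
  (`Scaling/Pseudofermions.lean`, `π = Prod.fst`).
* **T2-O/O′** — for any event `E`: `D(p‖q) ≥ p(E)·log(p(E)/q(E)) − 1` (`klFin_ge_event`),
  `ESS ≤ e·(q(E)/p(E))^{p(E)}` (`essFrac_le_exp_mul_rpow`), and if `p(E) ≥ 1/2` then
  `ESS ≤ e·√(2·q(E))` (`essFrac_le_exp_mul_sqrt`): a model must give EVERY half-mass set of the
  target probability `≥ (ESS/e)²/2`.  With the transport budget of `Scaling/Transport.lean`
  (`q(E) ≤ M·J·Haar(E)` for a push-forward model) this is the provable core of the COUPLING law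
  of THEORY-2.md §3.2; the Laplace-type smallness hypothesis (Gβ) of the target's half-mass set
  is NOT typed here.
-/

namespace Summit.Ventures.LatticeQCDFlow.Theory2

open Finset

variable {X : Type*} [Fintype X]

section CoarseGraining

variable {Y : Type*} [Fintype Y] [DecidableEq Y]

/-- Coarse-graining (push-forward) of a law on `X` along `π : X → Y` — e.g. `π` = the topological
charge, `Y` = the finite set of its values, `coarse π p` = the vector of SECTOR WEIGHTS.
[folklore] -/
noncomputable def coarse (π : X → Y) (p : X → ℝ) : Y → ℝ :=
  fun y => ∑ x ∈ univ.filter (fun x => π x = y), p x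

/-- Coarse-graining preserves total mass. [folklore] -/
theorem sum_coarse (π : X → Y) (p : X → ℝ) : ∑ y, coarse π p y = ∑ x, p x :=
  Finset.sum_fiberwise univ π p

omit [Fintype Y] in
/-- Coarse-graining preserves non-negativity. [folklore] -/
theorem coarse_nonneg (π : X → Y) {p : X → ℝ} (hp : ∀ x, 0 ≤ p x) (y : Y) :
    0 ≤ coarse π p y :=
  sum_nonneg fun x _ => hp x

omit [Fintype Y] in
/-- Along a surjective coarse-graining a positive law stays positive. [folklore] -/
theorem coarse_pos (π : X → Y) {p : X → ℝ} (hp : ∀ x, 0 < p x)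
    (hπ : Function.Surjective π) (y : Y) : 0 < coarse π p y := by
  obtain ⟨x, hx⟩ := hπ y
  exact sum_pos' (fun z _ => (hp z).le) ⟨x, by simp [hx], hp x⟩

open Literature.Probability.Entropy in
/-- **T2-P (KL half): data processing.**  Coarse-graining both laws along the same map cannot
increase the forward KL: `D(π_* p ‖ π_* q) ≤ D(p ‖ q)` (log-sum inequality per fibre).
[folklore; Polyanskiy–Wu Thm 7.4] -/
theorem klFin_coarse_le (π : X → Y) {p q : X → ℝ} (hp : ∀ x, 0 ≤ p x) (hq : ∀ x, 0 < q x) :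
    klFin (coarse π p) (coarse π q) ≤ klFin p q := by
  unfold klFin coarse
  rw [← Finset.sum_fiberwise univ π (fun x => p x * Real.log (p x / q x))]
  exact sum_le_sum fun y _ => sum_mul_log_div_le _ p q (fun i _ => hp i) (fun i _ => hq i)

/-- `χ²`-type sums drop under coarse-graining (Sedrakyan per fibre). [folklore] -/
theorem sum_sq_div_coarse_le (π : X → Y) (p q : X → ℝ) (hq : ∀ x, 0 < q x) :
    ∑ y, coarse π p y ^ 2 / coarse π q y ≤ ∑ x, p x ^ 2 / q x := by
  unfold coarse
  rw [← Finset.sum_fiberwise univ π (fun x => p x ^ 2 / q x)]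
  exact sum_le_sum fun y _ => Finset.sq_sum_div_le_sum_sq_div _ p fun x _ => hq x

/-- **T2-P (ESS half): the reweighting ESS of a flow sampler is at most the ESS of its SECTOR
WEIGHTS against the true sector weights** — for any coarse-graining `π` (topological charge,
Polyakov-loop sector, any order parameter): `ESS(p, q) ≤ ESS(π_* p, π_* q) = 1/(1 + χ²(π_*p ‖ π_*q))`.
A mixture / sector-conditioned model must therefore get the free energies `F_k = −log p(Q = k)`
right: the whole sampler's ESS is capped by the sector-weight fit alone ("no free lunch" of
THEORY-2 §5.2 evasion (iii), quantified).  Generalises `essFrac_le_essFrac_margU` (`π = Prod.fst`).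
[folklore; data processing for χ², Polyanskiy–Wu Thm 7.4] -/
theorem essFrac_le_essFrac_coarse (π : X → Y) {p q : X → ℝ} (hp1 : ∑ x, p x = 1)
    (hq : ∀ x, 0 < q x) (hq1 : ∑ x, q x = 1) (hπ : Function.Surjective π) :
    essFrac p q ≤ essFrac (coarse π p) (coarse π q) := by
  have hqY : ∀ y, 0 < coarse π q y := coarse_pos π hq hπ
  have hpY1 : ∑ y, coarse π p y = 1 := by rw [sum_coarse, hp1]
  have hqY1 : ∑ y, coarse π q y = 1 := by rw [sum_coarse, hq1]
  rw [essFrac_eq_inv hq hp1, essFrac_eq_inv hqY hpY1]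
  simp_rw [mul_weight_eq_sq_div]
  have hpos : 0 < ∑ y, coarse π p y ^ 2 / coarse π q y := by
    have h := Finset.sq_sum_div_le_sum_sq_div univ (coarse π p) (fun y _ => hqY y)
    rw [hpY1, hqY1] at h
    norm_num at h
    linarith
  exact inv_anti₀ hpos (sum_sq_div_coarse_le π p q hq)

end CoarseGraining

section EventBudget

open Literature.Probability.Entropy

variable [DecidableEq X]

/-- The forward KL dominates the binary KL of every event (data processing for `1_E`;
tree: `binaryKL_le_sum_mul_log_div`). [folklore] -/
theorem binaryKL_event_le_klFin (E : Finset X) {p q : X → ℝ} (hp : ∀ x, 0 ≤ p x)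
    (hq : ∀ x, 0 < q x) (hp1 : ∑ x, p x = 1) (hq1 : ∑ x, q x = 1) :
    binaryKL (∑ x ∈ E, p x) (∑ x ∈ E, q x) ≤ klFin p q := by
  unfold klFin
  exact binaryKL_le_sum_mul_log_div univ E (subset_univ E) p q (fun i _ => hp i)
    (fun i _ => hq i) hp1 hq1

omit [Fintype X] [DecidableEq X] in
/-- Elementary: `(1 − a) log((1 − a)/(1 − b)) ≥ −1` for `a ≤ 1`, `0 ≤ b ≤ 1`
(`u log u ≥ u − 1 ≥ −1`, `−u log v ≥ 0`). [folklore] -/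
theorem neg_one_le_one_sub_mul_log {a b : ℝ} (ha1 : a ≤ 1) (hb0 : 0 ≤ b) (hb1 : b ≤ 1) :
    -1 ≤ (1 - a) * Real.log ((1 - a) / (1 - b)) := by
  have hu0 : 0 ≤ 1 - a := by linarith
  have hv0 : 0 ≤ 1 - b := by linarith
  have hv1 : 1 - b ≤ 1 := by linarith
  rcases hv0.eq_or_lt with hv00 | hvpos
  · rw [← hv00, div_zero, Real.log_zero, mul_zero]; norm_num
  rcases hu0.eq_or_lt with hu00 | hupos
  · rw [← hu00, zero_mul]; norm_num
  rw [Real.log_div hupos.ne' hvpos.ne']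
  have hlogv : Real.log (1 - b) ≤ 0 := Real.log_nonpos hv0 hv1
  have hlogu : 1 - (1 - a)⁻¹ ≤ Real.log (1 - a) := Real.one_sub_inv_le_log_of_pos hupos
  have h1 : (1 - a) - 1 ≤ (1 - a) * Real.log (1 - a) := by
    have h := mul_le_mul_of_nonneg_left hlogu hu0
    have h' : (1 - a) * (1 - (1 - a)⁻¹) = (1 - a) - 1 := by
      rw [mul_sub, mul_one, mul_inv_cancel₀ hupos.ne']
    linarith
  have h3 : 0 ≤ (1 - a) * (-Real.log (1 - b)) := mul_nonneg hu0 (neg_nonneg.mpr hlogv)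
  have h4 : (1 - a) * (Real.log (1 - a) - Real.log (1 - b)) =
      (1 - a) * Real.log (1 - a) + (1 - a) * (-Real.log (1 - b)) := by ring
  rw [h4]
  linarith

/-- **T2-O (event budget).**  For every event `E`:
`D_KL(p‖q) ≥ p(E)·log(p(E)/q(E)) − 1`.  [folklore] -/
theorem klFin_ge_event (E : Finset X) {p q : X → ℝ} (hp : ∀ x, 0 ≤ p x)
    (hq : ∀ x, 0 < q x) (hp1 : ∑ x, p x = 1) (hq1 : ∑ x, q x = 1) :
    (∑ x ∈ E, p x) * Real.log ((∑ x ∈ E, p x) / (∑ x ∈ E, q x)) - 1 ≤ klFin p q := by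
  have hkl := binaryKL_event_le_klFin E hp hq hp1 hq1
  have ha1 : ∑ x ∈ E, p x ≤ 1 := by
    rw [← hp1]; exact sum_le_sum_of_subset_of_nonneg (subset_univ E) (fun x _ _ => hp x)
  have hb0 : 0 ≤ ∑ x ∈ E, q x := sum_nonneg fun x _ => (hq x).le
  have hb1 : ∑ x ∈ E, q x ≤ 1 := by
    rw [← hq1]; exact sum_le_sum_of_subset_of_nonneg (subset_univ E) (fun x _ _ => (hq x).le)
  have h := neg_one_le_one_sub_mul_log ha1 hb0 hb1
  rw [binaryKL] at hkl
  linarith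

/-- **T2-O (ESS form).**  `ESS/N ≤ e · (q(E)/p(E))^{p(E)}` for every non-empty event `E`:
a model that gives small mass to a set the target likes pays in ESS, whatever it does elsewhere.
[folklore] -/
theorem essFrac_le_exp_mul_rpow (E : Finset X) (hE : E.Nonempty) {p q : X → ℝ}
    (hp : ∀ x, 0 < p x) (hq : ∀ x, 0 < q x) (hp1 : ∑ x, p x = 1) (hq1 : ∑ x, q x = 1) :
    essFrac p q ≤
      Real.exp 1 * ((∑ x ∈ E, q x) / (∑ x ∈ E, p x)) ^ (∑ x ∈ E, p x) := by
  have ha0 : 0 < ∑ x ∈ E, p x := sum_pos (fun x _ => hp x) hE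
  have hb0 : 0 < ∑ x ∈ E, q x := sum_pos (fun x _ => hq x) hE
  have h1 := essFrac_le_exp_neg_kl hp hq hp1
  have h2 := klFin_ge_event E (fun x => (hp x).le) hq hp1 hq1
  have h3 : Real.exp (-klFin p q) ≤
      Real.exp (1 - (∑ x ∈ E, p x) * Real.log ((∑ x ∈ E, p x) / (∑ x ∈ E, q x))) :=
    Real.exp_le_exp.2 (by linarith)
  have h4 : Real.exp (1 - (∑ x ∈ E, p x) * Real.log ((∑ x ∈ E, p x) / (∑ x ∈ E, q x))) =
      Real.exp 1 * ((∑ x ∈ E, q x) / (∑ x ∈ E, p x)) ^ (∑ x ∈ E, p x) := by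
    rw [Real.rpow_def_of_pos (div_pos hb0 ha0), ← Real.exp_add]
    congr 1
    rw [show (∑ x ∈ E, q x) / (∑ x ∈ E, p x) = ((∑ x ∈ E, p x) / (∑ x ∈ E, q x))⁻¹ by
      rw [inv_div], Real.log_inv]
    ring
  exact h1.trans (h3.trans h4.le)

/-- **T2-O′ (concentration budget).**  If the target puts at least half of its mass on `E`, then
`ESS/N ≤ e·√(2·q(E))`: to reach ESS `≥ ε` the model must give EVERY half-mass set of the target
probability `≥ (ε/e)²/2`.  With `q = T_* ν` a flow push-forward, `q(E) ≤ M_ν · J_T · Haar(E)`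
(`Scaling/Transport.lean`), so concentration of the target on a Haar-small set forces a large
volume-contraction factor `J_T` — the COUPLING law of THEORY-2.md §3.2 (v1.4).  [folklore] -/
theorem essFrac_le_exp_mul_sqrt (E : Finset X) {p q : X → ℝ}
    (hp : ∀ x, 0 < p x) (hq : ∀ x, 0 < q x) (hp1 : ∑ x, p x = 1) (hq1 : ∑ x, q x = 1)
    (hE : 1 / 2 ≤ ∑ x ∈ E, p x) :
    essFrac p q ≤ Real.exp 1 * Real.sqrt (2 * ∑ x ∈ E, q x) := by
  have hEne : E.Nonempty := nonempty_of_sum_ne_zero (by linarith : ∑ x ∈ E, p x ≠ 0)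
  have ha0 : 0 < ∑ x ∈ E, p x := by linarith
  have hb0 : 0 < ∑ x ∈ E, q x := sum_pos (fun x _ => hq x) hEne
  have hmain := essFrac_le_exp_mul_rpow E hEne hp hq hp1 hq1
  by_cases h2b : 2 * ∑ x ∈ E, q x ≤ 1
  · have hba : (∑ x ∈ E, q x) / (∑ x ∈ E, p x) ≤ 2 * ∑ x ∈ E, q x := by
      rw [div_le_iff₀ ha0]; nlinarith
    have hba0 : 0 ≤ (∑ x ∈ E, q x) / (∑ x ∈ E, p x) := div_nonneg hb0.le ha0.le
    have h5 : ((∑ x ∈ E, q x) / (∑ x ∈ E, p x)) ^ (∑ x ∈ E, p x) ≤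
        (2 * ∑ x ∈ E, q x) ^ (∑ x ∈ E, p x) := Real.rpow_le_rpow hba0 hba ha0.le
    have h6 : (2 * ∑ x ∈ E, q x) ^ (∑ x ∈ E, p x) ≤ (2 * ∑ x ∈ E, q x) ^ (1 / 2 : ℝ) :=
      Real.rpow_le_rpow_of_exponent_ge (by linarith) h2b hE
    rw [Real.sqrt_eq_rpow]
    exact hmain.trans (mul_le_mul_of_nonneg_left (h5.trans h6) (Real.exp_pos 1).le)
  · have h2b : 1 < 2 * ∑ x ∈ E, q x := not_le.mp h2b
    have h7 : essFrac p q ≤ 1 := essFrac_le_one hq hp1 hq1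
    have h8 : 1 ≤ Real.exp 1 := Real.one_le_exp zero_le_one
    have h9 : 1 ≤ Real.sqrt (2 * ∑ x ∈ E, q x) := Real.one_le_sqrt.2 h2b.le
    exact h7.trans (one_le_mul_of_one_le_of_one_le h8 h9)

end EventBudget

end Summit.Ventures.LatticeQCDFlow.Theory2
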